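import Mathlib.LinearAlgebra.Matrix.Reindex
import Literature.AlgebraicGeometry.GroupSchemes.MultiplicativeGroupSchemeDet
import HarnessLib

/-!
# Reindexing the general linear group scheme: `GL_{σ,S} ≅ GL_{τ,S}` along `σ ≃ τ`

Görtz–Wedhorn, *Algebraic Geometry I*, (4.15) and Example 4.43 (1) (p. 116) define the group scheme
`GL_n` by its functor of points `GL_n(T) := GL_n(Γ(T, 𝒪_T))` and `GL_{n,S} := GL_n ×_ℤ S`, and
Definition 4.42 (p. 116) defines a homomorphism of `S`-group schemes as an `S`-morphism inducing group
homomorphisms on all `T`-valued points.  In the tree (`GroupSchemes/GeneralLinearGroupScheme.lean`,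
p756923) the index set is an arbitrary finite type `n` (`GLOver n S`, `pointsOver T : (T ⟶ GLOver n S)
≃ GL_n(Γ(T, 𝒪_T))`), exactly as for Mathlib's `Matrix.GeneralLinearGroup n R`; consumers meet it
at DIFFERENT index types for the same rank (`GLOver (Fin (Nat.card I + 1)) S` in
`GeneralLinearGroupActionProjectiveSpaceScheme.lean`, `GLOver (Fin (m + 1)) S` elsewhere).  This file
supplies the canonical identification, everything proved (no `sorry`, no new axiom, no named fact):

* §1 (rings) **`glReindex R e : GL σ R ≃* GL τ R`** for `e : σ ≃ τ` (Mathlib `Matrix.reindexRingEquiv`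
  on units), with `coe_glReindex` (the matrix is `Matrix.reindex e e`), `glReindex_symm/_refl/_trans`,
  naturality in the ring **`map_glReindex`** (`GL(φ) ∘ glReindex = glReindex ∘ GL(φ)`),
  **`det_glReindex`** (`det` is invariant) and `glReindex_scalar` (scalars go to scalars);
* §2 (schemes) **`reindexHom S e : GLOver σ S ⟶ GLOver τ S`**, defined by Yoneda at the universal
  point, with its action on points **`pointsOver_comp_reindexHom`**
  (`pointsOver T (f ≫ reindexHom S e) = glReindex _ e (pointsOver T f)`), functoriality
  `reindexHom_refl/_trans`, **`isMonHom_reindexHom`** (a homomorphism of `S`-group schemes, by the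
  pointwise test `isMonHom_of_points`), and the isomorphism **`reindexIso S e : GLOver σ S ≅ GLOver τ S`**
  (`reindexIso_hom/_inv`, `isMonHom_reindexIso_inv`);
* §3 compatibilities with the homomorphisms of `MultiplicativeGroupSchemeDet.lean`:
  **`reindexHom_comp_det`** (`reindexHom S e ≫ det τ S = det σ S`) and **`scalar_comp_reindexHom`**
  (`scalar σ S ≫ reindexHom S e = scalar τ S`).

Actions of `GL_{τ,S}` restrict to actions of `GL_{σ,S}` along `reindexHom S e` by Mathlib's
`ModObj.scalarRestriction` (given `isMonHom_reindexHom`), and conversely along `reindexHom S e.symm`.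

## References

* U. Görtz, T. Wedhorn, *Algebraic Geometry I: Schemes*, 2nd ed., Springer Spektrum (2020):
  (4.15) "Group schemes", Definition 4.42 and Example 4.43 (1) (p. 116). [GortzWedhorn2020]

## Design notes

* Consumer: the F-DAG of cell hodgecm-mathlib, item (h3): the by-name seam between
  `GroupSchemes/GeneralLinearGroupActionProjectiveSpaceScheme.lean` (index `Fin (Nat.card I + 1)`)
  and the F-6/F-8 files (index `Fin (m + 1)`); use `reindexIso S (finCongr h)`.
* Everything in §2–§3 is proved on `T`-valued points (injectivity of `pointsOver`, `pointsOver_comp`,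
  `pointsOver_one/_mul`, `unitsPoints_comp_det`, `pointsOver_comp_scalar`), never by unfolding the
  Yoneda transport of the group law.
* The ring-level isomorphism is called `glReindex` (not `reindexGL`) to avoid the name already used
  twice in Literature for FIELD coefficients (`NumberTheory.Automorphic.reindexGL` in
  `Automorphic/GLReindex.lean`, `UnitaryGroup.reindexGL`), which consumers of this file may have
  open simultaneously; here the coefficients are any commutative ring (`Γ(T, 𝒪_T)`).
* Mathlib / Literature searches: Mathlib has `Matrix.reindex`, `Matrix.reindexRingEquiv/AlgEquiv`,
  `Matrix.det_reindex_self`, `Matrix.submatrix_diagonal_equiv`, `Units.mapEquiv`,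
  `Matrix.GeneralLinearGroup.map/det/scalar`, `ModObj.scalarRestriction`; no reindexing of
  `Matrix.GeneralLinearGroup` and no `GL_n` scheme.  Literature: `GeneralLinearGroupScheme.*`
  (p756923, p758346), `MultiplicativeGroupSchemeDet` (p758973: `isMonHom_of_points`, `det`, `scalar`,
  `unitsPoints`).  Nothing is restated.
-/

universe u

open CategoryTheory Limits Opposite AlgebraicGeometry

noncomputable section

namespace Literature.AlgebraicGeometry.GroupSchemes

namespace GeneralLinearGroupScheme

/-! ### §1 Reindexing invertible matrices over a commutative ring -/

section Ring

variable {σ τ υ : Type*} [Fintype σ] [DecidableEq σ] [Fintype τ] [DecidableEq τ] [Fintype υ]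
  [DecidableEq υ]
variable (R : Type*) [CommRing R] {R' : Type*} [CommRing R']

/-- **The group isomorphism `GL_σ(R) ≃* GL_τ(R)` induced by a bijection `e : σ ≃ τ`** (simultaneous
renumbering of rows and columns; Mathlib's `Matrix.reindexRingEquiv` on units).  This is the map on
`R`-valued points of the identification `GL_{σ} ≅ GL_{τ}` of the group schemes of Example 4.43 (1).
[cite: GortzWedhorn2020, Example 4.43 (1), p. 116] -/
def glReindex (e : σ ≃ τ) : Matrix.GeneralLinearGroup σ R ≃* Matrix.GeneralLinearGroup τ R :=
  Units.mapEquiv (Matrix.reindexRingEquiv R e).toMulEquiv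

/-- The matrix of `glReindex R e g` is the reindexed matrix `Matrix.reindex e e g`, i.e. its `(i, j)`
entry is `g (e⁻¹ i) (e⁻¹ j)`. [cite: GortzWedhorn2020, Example 4.43 (1), p. 116] -/
@[simp]
theorem coe_glReindex (e : σ ≃ τ) (g : Matrix.GeneralLinearGroup σ R) :
    ((glReindex R e g : Matrix.GeneralLinearGroup τ R) : Matrix τ τ R) =
      Matrix.reindex e e (g : Matrix σ σ R) :=
  rfl

/-- Entries of the reindexed invertible matrix. [cite: GortzWedhorn2020, Example 4.43 (1), p. 116] -/
theorem glReindex_apply (e : σ ≃ τ) (g : Matrix.GeneralLinearGroup σ R) (i j : τ) :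
    (glReindex R e g : Matrix.GeneralLinearGroup τ R) i j = g (e.symm i) (e.symm j) :=
  rfl

/-- The inverse of `glReindex R e` is `glReindex R e.symm`. [cite: GortzWedhorn2020, Example 4.43 (1), p. 116] -/
theorem glReindex_symm (e : σ ≃ τ) : (glReindex R e).symm = glReindex R e.symm :=
  rfl

/-- `glReindex R e.symm (glReindex R e g) = g`. [cite: GortzWedhorn2020, Example 4.43 (1), p. 116] -/
@[simp]
theorem glReindex_symm_apply_apply (e : σ ≃ τ) (g : Matrix.GeneralLinearGroup σ R) :
    glReindex R e.symm (glReindex R e g) = g :=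
  (glReindex R e).symm_apply_apply g

/-- `glReindex R e (glReindex R e.symm g) = g`. [cite: GortzWedhorn2020, Example 4.43 (1), p. 116] -/
@[simp]
theorem glReindex_apply_symm_apply (e : σ ≃ τ) (g : Matrix.GeneralLinearGroup τ R) :
    glReindex R e (glReindex R e.symm g) = g :=
  (glReindex R e).apply_symm_apply g

/-- Reindexing along the identity is the identity. [cite: GortzWedhorn2020, Example 4.43 (1), p. 116] -/
@[simp]
theorem glReindex_refl (g : Matrix.GeneralLinearGroup σ R) : glReindex R (Equiv.refl σ) g = g :=
  Units.ext (Matrix.ext fun _ _ => rfl)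

/-- Reindexing is transitive: `glReindex e' ∘ glReindex e = glReindex (e.trans e')`.
[cite: GortzWedhorn2020, Example 4.43 (1), p. 116] -/
@[simp]
theorem glReindex_trans (e : σ ≃ τ) (e' : τ ≃ υ) (g : Matrix.GeneralLinearGroup σ R) :
    glReindex R e' (glReindex R e g) = glReindex R (e.trans e') g :=
  Units.ext (Matrix.ext fun _ _ => rfl)

/-- **Reindexing is natural in the ring**: for `φ : R → R'`,
`GL(φ) (glReindex R e g) = glReindex R' e (GL(φ) g)`. [cite: GortzWedhorn2020, Example 4.43 (1), p. 116] -/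
theorem map_glReindex (φ : R →+* R') (e : σ ≃ τ) (g : Matrix.GeneralLinearGroup σ R) :
    Matrix.GeneralLinearGroup.map φ (glReindex R e g) =
      glReindex R' e (Matrix.GeneralLinearGroup.map φ g) :=
  Units.ext (Matrix.ext fun _ _ => rfl)

/-- **The determinant is invariant under reindexing**: `det (glReindex R e g) = det g`.
[cite: GortzWedhorn2020, Example 4.43 (1), p. 116] -/
@[simp]
theorem det_glReindex (e : σ ≃ τ) (g : Matrix.GeneralLinearGroup σ R) :
    Matrix.GeneralLinearGroup.det (glReindex R e g) = Matrix.GeneralLinearGroup.det g :=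
  Units.ext (Matrix.det_reindex_self e (g : Matrix σ σ R))

/-- **Scalars are reindexed to scalars**: `glReindex R e (u · 1) = u · 1`.
[cite: GortzWedhorn2020, Example 4.43 (1), p. 116] -/
@[simp]
theorem glReindex_scalar (e : σ ≃ τ) (u : Rˣ) :
    glReindex R e (Matrix.GeneralLinearGroup.scalar σ u) = Matrix.GeneralLinearGroup.scalar τ u := by
  apply Units.ext
  change Matrix.reindex e e (Matrix.scalar σ (u : R)) = Matrix.scalar τ (u : R)
  rw [Matrix.reindex_apply, Matrix.scalar_apply, Matrix.scalar_apply, Matrix.submatrix_diagonal_equiv]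
  rfl

end Ring

/-! ### §2 The isomorphism of `S`-group schemes `GL_{σ,S} ≅ GL_{τ,S}` -/

open scoped MonObj

variable {σ τ υ : Type} [Fintype σ] [DecidableEq σ] [Fintype τ] [DecidableEq τ] [Fintype υ]
  [DecidableEq υ]
variable (S : Scheme.{u})

/-- **The reindexing morphism `GL_{σ,S} → GL_{τ,S}`** along `e : σ ≃ τ`, defined by Yoneda: the
`S`-point of `GL_{τ,S}` over `GL_{σ,S}` whose matrix is the reindexed universal matrix.
[cite: GortzWedhorn2020, Definition 4.42 and Example 4.43 (1), p. 116] -/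
def reindexHom (e : σ ≃ τ) : GLOver σ S ⟶ GLOver τ S :=
  (pointsOver (GLOver σ S)).symm (glReindex _ e (pointsOver (GLOver σ S) (𝟙 _)))

variable {S}

/-- **`reindexHom` on points**: the matrix of `f ≫ reindexHom S e` is the reindexed matrix of `f`.
[cite: GortzWedhorn2020, Definition 4.42 and Example 4.43 (1), p. 116] -/
@[simp]
theorem pointsOver_comp_reindexHom (e : σ ≃ τ) {T : Over S} (f : T ⟶ GLOver σ S) :
    pointsOver T (f ≫ reindexHom S e) = glReindex _ e (pointsOver T f) := by
  rw [pointsOver_comp, reindexHom, Equiv.apply_symm_apply, map_glReindex, ← pointsOver_comp,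
    Category.comp_id]

/-- The matrix of `reindexHom S e` itself (as an `S`-point of `GL_{τ,S}` over `GL_{σ,S}`) is the
reindexed universal matrix. [cite: GortzWedhorn2020, Example 4.43 (1), p. 116] -/
theorem pointsOver_reindexHom (e : σ ≃ τ) :
    pointsOver (GLOver σ S) (reindexHom S e) = glReindex _ e (pointsOver (GLOver σ S) (𝟙 _)) := by
  rw [← pointsOver_comp_reindexHom, Category.id_comp]

/-- Reindexing along the identity is the identity of `GL_{σ,S}`. [cite: GortzWedhorn2020, Example 4.43 (1), p. 116] -/
@[simp]
theorem reindexHom_refl : reindexHom S (Equiv.refl σ) = 𝟙 (GLOver σ S) := by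
  apply (pointsOver (GLOver σ S)).injective
  rw [pointsOver_reindexHom, glReindex_refl]

/-- **Functoriality**: `reindexHom S e ≫ reindexHom S e' = reindexHom S (e.trans e')`.
[cite: GortzWedhorn2020, Definition 4.42 and Example 4.43 (1), p. 116] -/
@[simp]
theorem reindexHom_trans (e : σ ≃ τ) (e' : τ ≃ υ) :
    reindexHom S e ≫ reindexHom S e' = reindexHom S (e.trans e') := by
  apply (pointsOver (GLOver σ S)).injective
  rw [pointsOver_comp_reindexHom, pointsOver_reindexHom, pointsOver_reindexHom, glReindex_trans]

/-- `reindexHom S e ≫ reindexHom S e.symm = 𝟙`. [cite: GortzWedhorn2020, Example 4.43 (1), p. 116] -/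
@[simp]
theorem reindexHom_comp_symm (e : σ ≃ τ) : reindexHom S e ≫ reindexHom S e.symm = 𝟙 (GLOver σ S) := by
  rw [reindexHom_trans, Equiv.self_trans_symm, reindexHom_refl]

/-- `reindexHom S e.symm ≫ reindexHom S e = 𝟙`. [cite: GortzWedhorn2020, Example 4.43 (1), p. 116] -/
@[simp]
theorem reindexHom_symm_comp (e : σ ≃ τ) : reindexHom S e.symm ≫ reindexHom S e = 𝟙 (GLOver τ S) := by
  rw [reindexHom_trans, Equiv.symm_trans_self, reindexHom_refl]

/-- **`reindexHom S e` is a homomorphism of `S`-group schemes** (Definition 4.42: it induces the group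
homomorphisms `glReindex _ e` on all `T`-valued points). [cite: GortzWedhorn2020, Definition 4.42 and Example 4.43 (1), p. 116] -/
theorem isMonHom_reindexHom (e : σ ≃ τ) : IsMonHom (reindexHom S e) := by
  refine isMonHom_of_points (reindexHom S e) (fun T => ?_) (fun T a b => ?_)
  · apply (pointsOver T).injective
    rw [pointsOver_comp_reindexHom, pointsOver_one, map_one, pointsOver_one]
  · apply (pointsOver T).injective
    rw [pointsOver_comp_reindexHom, pointsOver_mul, map_mul, pointsOver_mul, pointsOver_comp_reindexHom,
      pointsOver_comp_reindexHom]

variable (S) in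
/-- **The isomorphism of `S`-group schemes `GL_{σ,S} ≅ GL_{τ,S}` along `e : σ ≃ τ`** (inverse:
reindexing along `e.symm`). [cite: GortzWedhorn2020, Definition 4.42 and Example 4.43 (1), p. 116] -/
def reindexIso (e : σ ≃ τ) : GLOver σ S ≅ GLOver τ S where
  hom := reindexHom S e
  inv := reindexHom S e.symm
  hom_inv_id := reindexHom_comp_symm e
  inv_hom_id := reindexHom_symm_comp e

/-- The forward map of `reindexIso S e` is `reindexHom S e`. [cite: GortzWedhorn2020, Example 4.43 (1), p. 116] -/
@[simp]
theorem reindexIso_hom (e : σ ≃ τ) : (reindexIso S e).hom = reindexHom S e := rfl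

/-- The inverse map of `reindexIso S e` is `reindexHom S e.symm`. [cite: GortzWedhorn2020, Example 4.43 (1), p. 116] -/
@[simp]
theorem reindexIso_inv (e : σ ≃ τ) : (reindexIso S e).inv = reindexHom S e.symm := rfl

/-- `reindexIso S e.symm` is the inverse isomorphism. [cite: GortzWedhorn2020, Example 4.43 (1), p. 116] -/
theorem reindexIso_symm (e : σ ≃ τ) : (reindexIso S e).symm = reindexIso S e.symm := rfl

/-- The inverse of `reindexIso S e` is a homomorphism of `S`-group schemes too.
[cite: GortzWedhorn2020, Definition 4.42 and Example 4.43 (1), p. 116] -/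
theorem isMonHom_reindexIso_inv (e : σ ≃ τ) : IsMonHom (reindexIso S e).inv :=
  isMonHom_reindexHom e.symm

/-- **Points along the isomorphism**: `pointsOver T (f ≫ (reindexIso S e).hom) = glReindex _ e (pointsOver T f)`.
[cite: GortzWedhorn2020, Definition 4.42 and Example 4.43 (1), p. 116] -/
theorem pointsOver_comp_reindexIso_hom (e : σ ≃ τ) {T : Over S} (f : T ⟶ GLOver σ S) :
    pointsOver T (f ≫ (reindexIso S e).hom) = glReindex _ e (pointsOver T f) :=
  pointsOver_comp_reindexHom e f

/-- Points along the inverse isomorphism: `pointsOver T (f ≫ (reindexIso S e).inv) = glReindex _ e.symm (pointsOver T f)`.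
[cite: GortzWedhorn2020, Definition 4.42 and Example 4.43 (1), p. 116] -/
theorem pointsOver_comp_reindexIso_inv (e : σ ≃ τ) {T : Over S} (f : T ⟶ GLOver τ S) :
    pointsOver T (f ≫ (reindexIso S e).inv) = glReindex _ e.symm (pointsOver T f) :=
  pointsOver_comp_reindexHom e.symm f

/-- **The points bijection transported**: `S`-morphisms `T → GL_{σ,S}` and `T → GL_{τ,S}` correspond
under composition with `reindexIso S e` exactly as their matrices correspond under `glReindex _ e`.
[cite: GortzWedhorn2020, Definition 4.42 and Example 4.43 (1), p. 116] -/
theorem reindexIso_hom_eq_pointsOver_symm (e : σ ≃ τ) {T : Over S} (f : T ⟶ GLOver σ S) :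
    f ≫ (reindexIso S e).hom = (pointsOver T).symm (glReindex _ e (pointsOver T f)) := by
  apply (pointsOver T).injective
  rw [pointsOver_comp_reindexIso_hom, Equiv.apply_symm_apply]

/-! ### §3 Compatibility with `det` and with the scalars -/

/-- **Reindexing commutes with the determinant**: `reindexHom S e ≫ det τ S = det σ S`.
[cite: GortzWedhorn2020, Definition 4.42 and Example 4.43 (1), p. 116] -/
@[simp]
theorem reindexHom_comp_det (e : σ ≃ τ) : reindexHom S e ≫ det τ S = det σ S := by
  apply (unitsPoints (GLOver σ S)).injective
  rw [unitsPoints_comp_det, pointsOver_reindexHom, det_glReindex, ← unitsPoints_comp_det,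
    Category.id_comp]

/-- On points: `det` of the reindexed point equals `det` of the point. [cite: GortzWedhorn2020, Example 4.43 (1), p. 116] -/
theorem unitsPoints_comp_reindexHom_comp_det (e : σ ≃ τ) {T : Over S} (f : T ⟶ GLOver σ S) :
    unitsPoints T (f ≫ reindexHom S e ≫ det τ S) = Matrix.GeneralLinearGroup.det (pointsOver T f) := by
  rw [reindexHom_comp_det, unitsPoints_comp_det]

/-- **Reindexing fixes the scalars**: `scalar σ S ≫ reindexHom S e = scalar τ S`.
[cite: GortzWedhorn2020, Definition 4.42 and Example 4.43 (1), p. 116] -/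
@[simp]
theorem scalar_comp_reindexHom (e : σ ≃ τ) : scalar σ S ≫ reindexHom S e = scalar τ S := by
  apply (pointsOver (GmOver S)).injective
  rw [pointsOver_comp_reindexHom, ← Category.id_comp (scalar σ S), pointsOver_comp_scalar,
    glReindex_scalar, ← pointsOver_comp_scalar, Category.id_comp]

end GeneralLinearGroupScheme

end Literature.AlgebraicGeometry.GroupSchemes
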